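import Summits.AtomisticToContinuum.Crystallization.Theorems.HullMinimalityLayeredWindowsNecessitySites
import Summits.AtomisticToContinuum.Crystallization.Theorems.HullMinimalityLayeredWindowsFrequently

/-!
# Crux `HullMinimality.LayeredWindows` (stmt-AtomisticToContinuum-11778), line `registered`:
# NECESSITY of the positional leaf — layered windows consist of two-shell-good particles (lead c4, part 2b)

* `exists_frame_sites` — for a box word `s` and spacing `a ∈ [47/50, 1]` there are a linear isometry `F`,
  one of the two patterns `P` and a labelling `lab` of `P` by the eighteen two-shell labels, with
  `a • F v = layeredPos a s (idealZ a) (lab v)` (ideal sites) and `lab` onto the labels (part 1's frame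
  identity and bookkeeping);
* `good_of_sites` — abstract assembly: approximate sites near the particles give `IsTwoShellGood`;
* `isTwoShellGood_of_window` — a particle of a `1/3`-separated configuration lying `2` inside an
  `(R, 1/200)`-window (two-way `1/200`-match with a rigid image of a box template) is two-shell good
  (`IsTwoShellGood (1/20) (47/50) 1`): its eighteen neighbours sit within `1/200` of the actual sites, which
  are within `37a/1000` of the ideal ones (vertical relaxation of the box), total `< a/20`; the `3a/2`-
  neighbourhood is exhausted by `site_class_two`;
* `exists_site_norm_le_one` — every box template has a site within `1` of any prescribed centre height… of
  the origin (a layer within `17a/40` of height `0`, a lattice point of it within `2a/3` horizontally);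
* `cleanCentres_freq_of_layeredWindows`, `layeredWindows_iff_cleanCentresFreq` — the same windows make every deep
  particle `Good ∧ LayeredNear η` (the window itself is the local template), so the crux is EQUIVALENT, unconditionally,
  to "clean centres frequently": for every `(η, R')`, frequently in `N`, a particle whose `R'`-ball is all-`Good` and
  all-`LayeredNear η` (sufficiency is the landed `windowsOfGluing_freq` with the gluing lemma);
* `twoShellGoodWindows_freq_of_layeredWindows` — hence `HullMinimality.LayeredWindows` implies, along every
  Lennard-Jones ground-state sequence and for every radius `ρ`, FREQUENTLY in `N`, an all-two-shell-good
  `ρ`-ball: the frequently-form of stub S1 of the line is NECESSARY for the crux (and, with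
  `layeredWindows_of_goodWindows_freq`, equivalent to it modulo `NashNearField`).
-/

noncomputable section

open scoped BigOperators Classical
open Filter Topology

namespace Summit.AtomisticToContinuum.Crystallization.Theorems.LayeredWindowsLocal

open Summit.AtomisticToContinuum.Crystallization.Theses
open Summit.AtomisticToContinuum.Crystallization.Theorems.PrestressSplitKorn
open Summit.AtomisticToContinuum.Crystallization.Theorems.DefectFreeCrystallizes.Negative.PredicateAPI (Good)
open Literature.MathematicalPhysics.StatisticalMechanics Literature.Geometry.DiscreteGeometry
open Summit.AtomisticToContinuum.Crystallization.Theorems.ChargedEnergyGapNegative (E3)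

/-! ## A particle deep inside a window is two-shell good -/

/-- **Inside a window every particle is two-shell good.** Let `x` be `1/3`-separated and two-way
`1/200`-matched on `B(0, R)`, after the translation `t`, with the rigid image `A ''` of a box template
`layeredPos a s z` (`InBox a z`, `IsHaggSeq s`). Then every particle `j` with `‖x j + t‖ + 2 ≤ R` is
`IsTwoShellGood (1/20) (47/50) 1`. -/
theorem isTwoShellGood_of_window {N : ℕ} {x : Fin N → E3}
    (hsep : ∀ i j : Fin N, i ≠ j → (1 / 3 : ℝ) ≤ dist (x i) (x j))
    {A : E3 →ₗᵢ[ℝ] E3} {t : E3} {a : ℝ} {s : ℤ → ℤ} {z : ℤ → ℝ}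
    (hbox : InBox a z) (hs : IsHaggSeq s) {R : ℝ}
    (h1 : ∀ p ∈ Set.range (fun l : ℤ × ℤ × ℤ => A (layeredPos a s z l)), ‖p‖ ≤ R →
      ∃ i : Fin N, dist (x i + t) p ≤ 1 / 200)
    (h2 : ∀ i : Fin N, ‖x i + t‖ ≤ R →
      ∃ p ∈ Set.range (fun l : ℤ × ℤ × ℤ => A (layeredPos a s z l)), dist (x i + t) p ≤ 1 / 200)
    {j : Fin N} (hj : ‖x j + t‖ + 2 ≤ R) :
    IsTwoShellGood (1 / 20) (47 / 50) 1 x j := by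
  have ha47 := hbox.1
  have ha1 := hbox.2.1
  have ha := hbox.a_pos
  -- the site of `j`
  obtain ⟨_, ⟨l₀, rfl⟩, hd₀⟩ := h2 j (by linarith)
  dsimp only at hd₀
  set p₀ : E3 := A (layeredPos a s z l₀) with hp₀
  -- the re-based template
  have hbox' := hbox.shift l₀.1
  have hsh := isHaggSeq_shift hs l₀.1
  have hshift := layeredPos_shift a s z l₀
  have hz0 : (fun k => z (k + l₀.1) - z l₀.1) 0 = 0 := by simp
  generalize (fun k => s (k + l₀.1)) = s' at hbox' hsh hshift hz0
  generalize (fun k => z (k + l₀.1) - z l₀.1) = z' at hbox' hsh hshift hz0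
  -- `S = p₀ + A (template')`
  have hmem : ∀ q : ℤ × ℤ × ℤ, p₀ + A (layeredPos a s' z' q) ∈
      Set.range (fun l : ℤ × ℤ × ℤ => A (layeredPos a s z l)) := by
    intro q
    refine ⟨q + l₀, ?_⟩
    simp only [hp₀, hshift q, map_sub]
    abel
  have hrepr : ∀ l : ℤ × ℤ × ℤ, A (layeredPos a s z l) = p₀ + A (layeredPos a s' z' (l - l₀)) := by
    intro l
    have := hshift (l - l₀)
    rw [sub_add_cancel] at this
    rw [this, map_sub, hp₀]
    abel
  -- the frame and the labelled ideal sites of the re-based word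
  obtain ⟨F, P, lab, hP, hideal, hlab1, hsurj⟩ := exists_frame_sites hsh ha47 ha1
  -- the actual sites
  refine good_of_sites hsep ha47 ha1 (A.comp F) hP (fun v => p₀ + A (layeredPos a s' z' (lab v))) t p₀
    ?_ ?_ hd₀ ?_
  · -- (S1) every site is an `S`-point in the window, hence carries a particle
    intro v hv
    refine h1 _ (hmem (lab v)) ?_
    have hq := hlab1 v hv
    have hn1 : ‖layeredPos a s' z' (lab v)‖ ≤ ‖layeredPos a s' (idealZ a) (lab v)‖ + 37 / 1000 * a := by
      have := dist_site_ideal_le (s := s') hbox' hz0 hq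
      rw [dist_eq_norm] at this
      calc ‖layeredPos a s' z' (lab v)‖
          = ‖(layeredPos a s' z' (lab v) - layeredPos a s' (idealZ a) (lab v)) + layeredPos a s' (idealZ a) (lab v)‖ := by
              rw [sub_add_cancel]
        _ ≤ ‖layeredPos a s' z' (lab v) - layeredPos a s' (idealZ a) (lab v)‖ + ‖layeredPos a s' (idealZ a) (lab v)‖ :=
              norm_add_le _ _
        _ ≤ _ := by linarith
    have hn2 : ‖layeredPos a s' (idealZ a) (lab v)‖ ≤ Real.sqrt 2 * a := by
      rw [← hideal v hv, norm_smul, LinearIsometry.norm_map, Real.norm_of_nonneg ha.le]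
      have := norm_le_sqrt_two_of_mem_twoShellPattern hP hv
      nlinarith
    have hs2 : Real.sqrt 2 ≤ 1.415 := by
      rw [Real.sqrt_le_left (by norm_num)]; norm_num
    have hs2a : Real.sqrt 2 * a ≤ 1.415 * a := mul_le_mul_of_nonneg_right hs2 ha.le
    have hp₀n : ‖p₀‖ ≤ ‖x j + t‖ + 1 / 200 := by
      calc ‖p₀‖ = dist p₀ 0 := (dist_zero_right _).symm
        _ ≤ dist p₀ (x j + t) + dist (x j + t) 0 := dist_triangle _ _ _
        _ = dist (x j + t) p₀ + ‖x j + t‖ := by rw [dist_comm, dist_zero_right]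
        _ ≤ _ := by linarith
    calc ‖p₀ + A (layeredPos a s' z' (lab v))‖ ≤ ‖p₀‖ + ‖A (layeredPos a s' z' (lab v))‖ := norm_add_le _ _
      _ = ‖p₀‖ + ‖layeredPos a s' z' (lab v)‖ := by rw [A.norm_map (layeredPos a s' z' (lab v))]
      _ ≤ R := by linarith
  · -- (S2) actual versus ideal site
    intro v hv
    have := dist_site_ideal_le (s := s') hbox' hz0 (hlab1 v hv)
    rw [dist_add_left]
    show dist (A (layeredPos a s' z' (lab v))) (a • A (F v)) ≤ 37 / 1000 * a
    rwa [← A.map_smul, hideal v hv, LinearIsometry.dist_map]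
  · -- (S4) every other particle within `3a/2` of `x j` sits at a site
    intro j' hj' hd
    have hj'R : ‖x j' + t‖ ≤ R := by
      calc ‖x j' + t‖ = dist (x j' + t) 0 := (dist_zero_right _).symm
        _ ≤ dist (x j' + t) (x j + t) + dist (x j + t) 0 := dist_triangle _ _ _
        _ = dist (x j') (x j) + ‖x j + t‖ := by rw [dist_add_right, dist_zero_right]
        _ ≤ R := by nlinarith
    obtain ⟨_, ⟨l', rfl⟩, hd'⟩ := h2 j' hj'R
    dsimp only at hd'
    set q' : ℤ × ℤ × ℤ := l' - l₀ with hq'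
    have hp' : A (layeredPos a s z l') = p₀ + A (layeredPos a s' z' q') := hrepr l'
    rw [hp'] at hd'
    -- `q'` is a nonzero site of norm `≤ 38a/25`
    have hq'0 : q' ≠ 0 := by
      intro h0
      have hz00 : layeredPos a s' z' 0 = 0 := by
        have := hshift 0
        rw [zero_add, sub_self] at this
        exact this
      rw [h0, hz00, map_zero, add_zero] at hd'
      have : j' = j := by
        by_contra hne
        have h1 := hsep j' j hne
        have h2 : dist (x j') (x j) ≤ 1 / 200 + 1 / 200 := by
          calc dist (x j') (x j) = dist (x j' + t) (x j + t) := by rw [dist_add_right]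
            _ ≤ dist (x j' + t) p₀ + dist (x j + t) p₀ := dist_triangle_right _ _ _
            _ ≤ _ := add_le_add hd' hd₀
        linarith
      exact hj' this
    have hq'n : ‖layeredPos a s' z' q'‖ ≤ 38 / 25 * a := by
      have e : ‖layeredPos a s' z' q'‖ = dist (p₀ + A (layeredPos a s' z' q')) p₀ := by
        rw [dist_eq_norm, add_sub_cancel_left, LinearIsometry.norm_map]
      rw [e]
      calc dist (p₀ + A (layeredPos a s' z' q')) p₀
          ≤ dist (p₀ + A (layeredPos a s' z' q')) (x j' + t) + dist (x j' + t) (x j + t) + dist (x j + t) p₀ :=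
            dist_triangle4 _ _ _ _
        _ = dist (x j' + t) (p₀ + A (layeredPos a s' z' q')) + dist (x j') (x j) + dist (x j + t) p₀ := by
            rw [dist_comm, dist_add_right]
        _ ≤ 1 / 200 + 3 / 2 * a + 1 / 200 := by gcongr
        _ ≤ 38 / 25 * a := by linarith
    have hcls := site_class_two hbox' hsh hz0 hq'0 hq'n
    obtain ⟨v, hv, hlv⟩ := hsurj q' hcls
    refine ⟨v, hv, ?_⟩
    show dist (x j' + t) (p₀ + A (layeredPos a s' z' (lab v))) ≤ 1 / 200
    rw [hlv]
    exact hd'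

/-! ## A site near the origin -/

/-- **Every box template has a site within `1` of the origin** (after any linear isometry): some layer
has height within `17a/40` of `0` (the increments are at most `17a/20`), and within it some lattice point
is within `2a/3` of the foot of the origin (`exists_planar_near`). -/
theorem exists_site_norm_le_one {a : ℝ} {s : ℤ → ℤ} {z : ℤ → ℝ} (hbox : InBox a z)
    (A : E3 →ₗᵢ[ℝ] E3) : ∃ l : ℤ × ℤ × ℤ, ‖A (layeredPos a s z l)‖ ≤ 1 := by
  have ha := hbox.a_pos
  have ha1 := hbox.2.1
  have hsm := hbox.strictMono
  -- a layer of small height: the last layer of non-positive height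
  have hlow : ∃ m : ℤ, z m ≤ 0 := by
    obtain ⟨n, hn⟩ := exists_nat_ge (z 0 / (39 / 50 * a))
    refine ⟨-(n : ℤ), ?_⟩
    have h := (hbox.le_z_neg_natCast n).1
    have : z 0 ≤ 39 / 50 * a * n := by
      rw [div_le_iff₀ (by positivity)] at hn
      linarith
    linarith
  have hbdd : ∃ b : ℤ, ∀ m : ℤ, z m ≤ 0 → m ≤ b := by
    obtain ⟨n, hn⟩ := exists_nat_gt (-z 0 / (39 / 50 * a))
    refine ⟨n, fun m hm => ?_⟩
    by_contra hc
    push Not at hc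
    have h := (hbox.le_z_natCast n).1
    have hpos : -z 0 < 39 / 50 * a * n := by
      rw [div_lt_iff₀ (by positivity)] at hn
      linarith
    have : z n ≤ z m := hsm.monotone hc.le
    linarith
  obtain ⟨m, hm, hmax⟩ := Int.exists_greatest_of_bdd hbdd hlow
  have hm1 : 0 < z (m + 1) := by
    by_contra hc
    push Not at hc
    have := hmax (m + 1) hc
    omega
  have hinc := hbox.2.2 m
  -- the layer `m` or `m + 1` has `|height| ≤ 17a/40`
  obtain ⟨k, hk⟩ : ∃ k : ℤ, |z k| ≤ 17 / 40 * a := by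
    rcases le_or_gt (-z m) (17 / 40 * a) with h | h
    · exact ⟨m, by rw [abs_of_nonpos hm]; exact h⟩
    · exact ⟨m + 1, by rw [abs_of_pos hm1]; linarith [hinc.2]⟩
  -- a lattice point of that layer near the foot of the origin
  set d : E3 := -((haggLabel s k : ℝ) • barlowOffset a) with hd
  have hd2 : d 2 = 0 := by simp [hd, barlowOffset]
  obtain ⟨i, j, hij⟩ := exists_planar_near ha d hd2
  refine ⟨(k, i, j), ?_⟩
  rw [LinearIsometry.norm_map]
  have hdecomp : layeredPos a s z (k, i, j) =
      (((i : ℝ) • triangularVec₁ a + (j : ℝ) • triangularVec₂ a) - d) + z k • layerNormal 1 := by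
    simp only [layeredPos, hd]
    abel
  have hhor : ((((i : ℝ) • triangularVec₁ a + (j : ℝ) • triangularVec₂ a) - d) : E3) 2 = 0 := by
    simp [hd, triangularVec₁, triangularVec₂, barlowOffset]
  have hsq : ‖layeredPos a s z (k, i, j)‖ ^ 2 =
      ‖((i : ℝ) • triangularVec₁ a + (j : ℝ) • triangularVec₂ a) - d‖ ^ 2 + z k ^ 2 := by
    rw [hdecomp, PrestressSplitKorn.norm_sq_fin3, PrestressSplitKorn.norm_sq_fin3]
    simp only [PiLp.add_apply, PiLp.smul_apply, smul_eq_mul, hhor]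
    simp [layerNormal]
  have h1 : ‖((i : ℝ) • triangularVec₁ a + (j : ℝ) • triangularVec₂ a) - d‖ ^ 2 ≤ 4 * a ^ 2 / 9 := by
    rw [← norm_neg, neg_sub]; exact hij
  have h2 : z k ^ 2 ≤ (17 / 40 * a) ^ 2 := by
    have := sq_abs (z k); nlinarith [abs_nonneg (z k)]
  have h3 : ‖layeredPos a s z (k, i, j)‖ ^ 2 ≤ 1 := by nlinarith
  nlinarith [norm_nonneg (layeredPos a s z (k, i, j))]

/-! ## The crux is equivalent to clean centres frequently -/

/-- **`LayeredWindows` implies clean centres, frequently.** Along every ground-state sequence, for every `η > 0` and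
`R'`, FREQUENTLY in `N`, some particle has every particle within `R'` of it crux-`Good` AND `LayeredNear η`: inside an
`(R, min (1/200) η)`-window the deep particles are two-shell good (`isTwoShellGood_of_window`, hence `Good`), and the
window's own template, read on the radius-`2` ball of each deep particle, witnesses `LayeredNear η`. -/
theorem cleanCentres_freq_of_layeredWindows
    (hLW : Summit.AtomisticToContinuum.Crystallization.Theses.HullMinimality.LayeredWindows)
    (x : (N : ℕ) → (Fin N → E3)) (hx : ∀ N, IsGroundState lennardJones (x N)) :
    ∀ η : ℝ, 0 < η → ∀ R' : ℝ, ∃ᶠ N : ℕ in atTop, ∃ i : Fin N, ∀ j : Fin N,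
      dist (x N j) (x N i) ≤ R' → Good (x N) j ∧ LayeredNear η (x N) j := by
  intro η hη R'
  obtain ⟨a, ha47, ha1, hwin⟩ := hLW x hx
  have hε : (0 : ℝ) < min (1 / 200) η := lt_min (by norm_num) hη
  have hfreq := hwin (|R'| + 6) (min (1 / 200) η) hε
  refine hfreq.mono fun N hN => ?_
  obtain ⟨A, t, s, z, hs, hz, h12⟩ := hN
  dsimp only at h12
  rw [← HullBridgeExact.wg_range_layeredPos_eq] at h12
  obtain ⟨h1, h2⟩ := h12
  have hbox : InBox a z := ⟨ha47, ha1, hz⟩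
  have hinj : Function.Injective (x N) := (hx N).1
  have hsep : ∀ i j : Fin N, i ≠ j → (1 / 3 : ℝ) ≤ dist (x N i) (x N j) := fun i j hij =>
    ZeroDefectDensity.third_le_dist_of_isGroundState (hx N) hij
  -- the `1/200`-window read off the `min (1/200) η`-window
  have h1' : ∀ p ∈ Set.range (fun l : ℤ × ℤ × ℤ => A (layeredPos a s z l)), ‖p‖ ≤ |R'| + 6 →
      ∃ i : Fin N, dist (x N i + t) p ≤ 1 / 200 := fun p hp hpR => by
    obtain ⟨i, hi⟩ := h1 p hp hpR
    exact ⟨i, hi.trans (min_le_left _ _)⟩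
  have h2' : ∀ i : Fin N, ‖x N i + t‖ ≤ |R'| + 6 →
      ∃ p ∈ Set.range (fun l : ℤ × ℤ × ℤ => A (layeredPos a s z l)), dist (x N i + t) p ≤ 1 / 200 := fun i hi => by
    obtain ⟨p, hp, hd⟩ := h2 i hi
    exact ⟨p, hp, hd.trans (min_le_left _ _)⟩
  -- a particle near the centre of the window
  obtain ⟨l, hl⟩ := exists_site_norm_le_one hbox A (s := s)
  obtain ⟨i₀, hi₀⟩ := h1' _ ⟨l, rfl⟩ (by linarith [abs_nonneg R'])
  have hi₀n : ‖x N i₀ + t‖ ≤ 1 + 1 / 200 := by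
    calc ‖x N i₀ + t‖ = dist (x N i₀ + t) 0 := (dist_zero_right _).symm
      _ ≤ dist (x N i₀ + t) (A (layeredPos a s z l)) + dist (A (layeredPos a s z l)) 0 := dist_triangle _ _ _
      _ ≤ 1 / 200 + 1 := by rw [dist_zero_right]; exact add_le_add hi₀ hl
      _ = 1 + 1 / 200 := by ring
  refine ⟨i₀, fun j hj => ?_⟩
  have hρ : dist (x N j) (x N i₀) ≤ |R'| := hj.trans (le_abs_self R')
  have hjn : ‖x N j + t‖ + 2 ≤ |R'| + 6 := by
    calc ‖x N j + t‖ + 2 ≤ (dist (x N j + t) (x N i₀ + t) + ‖x N i₀ + t‖) + 2 := by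
          gcongr
          calc ‖x N j + t‖ = dist (x N j + t) 0 := (dist_zero_right _).symm
            _ ≤ dist (x N j + t) (x N i₀ + t) + dist (x N i₀ + t) 0 := dist_triangle _ _ _
            _ = _ := by rw [dist_zero_right]
      _ = dist (x N j) (x N i₀) + ‖x N i₀ + t‖ + 2 := by rw [dist_add_right]
      _ ≤ |R'| + 6 := by linarith
  constructor
  · exact HullBridgeExact.cc_good_of_isTwoShellGood hinj (isTwoShellGood_of_window hsep hbox hs h1' h2' hjn)
  · refine ⟨A, t, a, s, z, hbox, hs, ?_⟩
    dsimp only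
    constructor
    · intro j' hj'
      have hj'R : ‖x N j' + t‖ ≤ |R'| + 6 := by
        calc ‖x N j' + t‖ = dist (x N j' + t) 0 := (dist_zero_right _).symm
          _ ≤ dist (x N j' + t) (x N j + t) + dist (x N j + t) 0 := dist_triangle _ _ _
          _ = dist (x N j') (x N j) + ‖x N j + t‖ := by rw [dist_add_right, dist_zero_right]
          _ ≤ |R'| + 6 := by linarith
      obtain ⟨p, hp, hd⟩ := h2 j' hj'R
      exact ⟨p, hp, hd.trans (min_le_right _ _)⟩
    · intro p hp hpj
      have hpR : ‖p‖ ≤ |R'| + 6 := by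
        calc ‖p‖ = dist p 0 := (dist_zero_right _).symm
          _ ≤ dist p (x N j + t) + dist (x N j + t) 0 := dist_triangle _ _ _
          _ = dist p (x N j + t) + ‖x N j + t‖ := by rw [dist_zero_right]
          _ ≤ |R'| + 6 := by linarith
      obtain ⟨i, hi⟩ := h1 p hp hpR
      exact ⟨i, hi.trans (min_le_right _ _)⟩

/-- **The crux is equivalent to "clean centres frequently"** (unconditionally): `LayeredWindows` holds iff along
every Lennard-Jones ground-state sequence, for every `η > 0` and `R'`, frequently in `N`, some particle has its whole
`R'`-ball crux-`Good` and `LayeredNear η` — necessity `cleanCentres_freq_of_layeredWindows`, sufficiency the landed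
`windowsOfGluing_freq` with the gluing lemma `PrestressSplitKorn.stub_layeredGluing`. -/
theorem layeredWindows_iff_cleanCentresFreq :
    Summit.AtomisticToContinuum.Crystallization.Theses.HullMinimality.LayeredWindows ↔
      ∀ x : (N : ℕ) → (Fin N → E3), (∀ N, IsGroundState lennardJones (x N)) →
        ∀ η : ℝ, 0 < η → ∀ R' : ℝ, ∃ᶠ N : ℕ in atTop, ∃ i : Fin N, ∀ j : Fin N,
          dist (x N j) (x N i) ≤ R' → Good (x N) j ∧ LayeredNear η (x N) j :=
  ⟨cleanCentres_freq_of_layeredWindows, fun h x hx => windowsOfGluing_freq stub_layeredGluing x hx (h x hx)⟩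

/-! ## The necessity theorem -/

/-- **`LayeredWindows` implies all-two-shell-good balls, frequently.** If the crux
`HullMinimality.LayeredWindows` holds then along every Lennard-Jones ground-state sequence and for every
radius `ρ`, FREQUENTLY in `N`, some particle has every particle within `ρ` of it two-shell good
(`IsTwoShellGood (1/20) (47/50) 1`) — the frequently-in-`N` form of stub S1 of line `registered`.
(Windows at scale `(|ρ| + 4, 1/200)`; a particle within `1/200` of a site within `1` of the centre;
`isTwoShellGood_of_window`.) -/
theorem twoShellGoodWindows_freq_of_layeredWindows
    (hLW : Summit.AtomisticToContinuum.Crystallization.Theses.HullMinimality.LayeredWindows)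
    (x : (N : ℕ) → (Fin N → E3)) (hx : ∀ N, IsGroundState lennardJones (x N)) (ρ : ℝ) :
    ∃ᶠ N : ℕ in atTop, ∃ i : Fin N, ∀ j : Fin N,
      dist (x N j) (x N i) ≤ ρ → IsTwoShellGood (1 / 20) (47 / 50) 1 (x N) j := by
  obtain ⟨a, ha47, ha1, hwin⟩ := hLW x hx
  have hfreq := hwin (|ρ| + 4) (1 / 200) (by norm_num)
  refine hfreq.mono fun N hN => ?_
  obtain ⟨A, t, s, z, hs, hz, h12⟩ := hN
  dsimp only at h12
  rw [← HullBridgeExact.wg_range_layeredPos_eq] at h12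
  obtain ⟨h1, h2⟩ := h12
  have hbox : InBox a z := ⟨ha47, ha1, hz⟩
  have hsep : ∀ i j : Fin N, i ≠ j → (1 / 3 : ℝ) ≤ dist (x N i) (x N j) := fun i j hij =>
    ZeroDefectDensity.third_le_dist_of_isGroundState (hx N) hij
  -- a particle near the centre of the window
  obtain ⟨l, hl⟩ := exists_site_norm_le_one hbox A (s := s)
  obtain ⟨i₀, hi₀⟩ := h1 _ ⟨l, rfl⟩ (by linarith [abs_nonneg ρ])
  have hi₀n : ‖x N i₀ + t‖ ≤ 1 + 1 / 200 := by
    calc ‖x N i₀ + t‖ = dist (x N i₀ + t) 0 := (dist_zero_right _).symm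
      _ ≤ dist (x N i₀ + t) (A (layeredPos a s z l)) + dist (A (layeredPos a s z l)) 0 := dist_triangle _ _ _
      _ ≤ 1 / 200 + 1 := by rw [dist_zero_right]; exact add_le_add hi₀ hl
      _ = 1 + 1 / 200 := by ring
  refine ⟨i₀, fun j hj => ?_⟩
  refine isTwoShellGood_of_window hsep hbox hs h1 h2 ?_
  have hρ : dist (x N j) (x N i₀) ≤ |ρ| := hj.trans (le_abs_self ρ)
  calc ‖x N j + t‖ + 2 ≤ (dist (x N j + t) (x N i₀ + t) + ‖x N i₀ + t‖) + 2 := by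
        gcongr
        calc ‖x N j + t‖ = dist (x N j + t) 0 := (dist_zero_right _).symm
          _ ≤ dist (x N j + t) (x N i₀ + t) + dist (x N i₀ + t) 0 := dist_triangle _ _ _
          _ = _ := by rw [dist_zero_right]
    _ = dist (x N j) (x N i₀) + ‖x N i₀ + t‖ + 2 := by rw [dist_add_right]
    _ ≤ |ρ| + 4 := by linarith

/-- **Necessity, quantified over all sequences** (landing anchor, registered sub-goal of crux
stmt-AtomisticToContinuum-11778): `LayeredWindows` implies the frequently-in-`N` form of stub S1 of line
`registered` (all-two-shell-good balls of every radius along every ground-state sequence). -/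
theorem layeredWindows_necessity : Summit.AtomisticToContinuum.Crystallization.Theses.HullMinimality.LayeredWindows → ∀ x : (N : ℕ) → (Fin N → EuclideanSpace ℝ (Fin 3)), (∀ N, Literature.MathematicalPhysics.StatisticalMechanics.IsGroundState Literature.MathematicalPhysics.StatisticalMechanics.lennardJones (x N)) → ∀ ρ : ℝ, ∃ᶠ N : ℕ in Filter.atTop, ∃ i : Fin N, ∀ j : Fin N, dist (x N j) (x N i) ≤ ρ → Literature.Geometry.DiscreteGeometry.IsTwoShellGood (1 / 20) (47 / 50) 1 (x N) j :=
  fun hLW x hx ρ => twoShellGoodWindows_freq_of_layeredWindows hLW x hx ρ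

end Summit.AtomisticToContinuum.Crystallization.Theorems.LayeredWindowsLocal

end
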